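import Summits.NavierStokesRegularity.NavierStokesRegularity.Theorems.TypeILiouvilleTypeIliouvilleNoTypeIIEternalSplitModL
import Summits.NavierStokesRegularity.NavierStokesRegularity.Theorems.TypeILiouvilleTypeIliouvilleNoTypeIITypeIIZoomFatou
import HarnessLib

/-!
# `Clay (A) ⇐ ASlab ∧ (L)`: modulo KNSS's Liouville conjecture, no-Type-II reduces to an a-priori
# bound on the scaled local KINETIC ENERGY alone (crux `TypeIliouvilleNoTypeII`,
# stmt-NavierStokesRegularity-0056; hard core (L) = `TypeIliouvilleL`, stmt-NavierStokesRegularity-10661)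

Helper file (theorems only).  `…EternalSplitModL.lean` proved `NoTypeII ⇐ S₁′ ∧ (L)` with S₁′ the
pressure-free energy-Type-I slab clause (Albritton–Barker's `A`, `C`, `E` of the viscosity-normalised
field bounded on the balls of a final slab), and observed that the rigidity side uses the `A`-clause
only.  This file runs the TRANSFER on `A` alone as well (ns-typeII-p1's transport identity
`EternalSplit.cknAEss_windowZoom` + `image_ball_subset_slab`, and the Fatou step
`TypeIIZoom.cknAEss_zoomLimit_le`), so that the whole chain needs one scalar a-priori estimate:

  **ASlab** — for every maximal smooth solution `(u, p)` of Navier–Stokes on `ℝ³ × [0, T)`,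
  Leray–Hopf from a rapidly decaying datum, there are `S₁ < νT` and `I < ∞` with
  `A(ũ; Q_r(z)) = ess sup_{t ∈ (t₀ - r², t₀)} r⁻¹ ∫_{B_r(x₀)} |ũ(t)|² ≤ I` for every parabolic ball
  `Q_r(z) ⊆ (S₁, νT) × ℝ³`, where `ũ(s, x) = ν⁻¹ u(s/ν, x)` is the unit-viscosity normalisation
  (`timeRescale ν⁻¹ ν⁻¹ u`).

* `transfer_cknAEssBound` — ASlab's bound passes to the limit of the Type-II zoom package on ALL
  parabolic balls of `ℝ × ℝ³`;
* `isTypeIBlowup_of_cknAEssSlab_of_liouvilleL` — per solution: (L) ∧ the `A`-slab bound ⇒ Type-I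
  rate (the door-calculus KILL for the clause «`A`-slab bound», modulo (L));
* `typeIliouvilleNoTypeII_of_cknAEssSlab_of_liouvilleL` — `NoTypeII ⇐ ASlab ∧ (L)` BY NAME;
* `navierStokesRegularity_of_cknAEssSlab_of_liouvilleL` — `Clay (A) ⇐ ASlab ∧ (L)` through the
  deciding theorem of route `TypeILiouville`.

READING.  In the critics' REACH lattice ASlab is below C1′ (it is one of the four summands of
Albritton–Barker's `𝐈`) and below C2 (`‖u(t)‖_{L^{3,∞}} ≤ M` gives `∫_{B_r}|u|² ≲ M² r`); so MODULO
(L) — which route `TypeILiouville` pays for anyway — every candidate reaching C2, C1′ or merely the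
`A`-part of C1′ reaches C3 = 0056.  WHAT THIS IS NOT: not NS regularity; ASlab and (L) are OPEN, and
nothing here says ASlab is plausible (finite energy gives `A(Q_r) ≤ E₀/(ν r)` only, no uniform bound
on small balls near the blow-up).
-/

noncomputable section

-- the summit and its single problem share the name `NavierStokesRegularity` (D-0017 nested layout)
set_option linter.dupNamespace false

open Set Function Filter Topology MeasureTheory Metric
open scoped NNReal ENNReal

namespace Summit.NavierStokesRegularity.NavierStokesRegularity.Theorems.TypeIliouvilleNoTypeII.TypeIIZoom

open Literature.Analysis Literature.Analysis.FluidPDE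
open Summit.NavierStokesRegularity.NavierStokesRegularity.Theorems.TypeIliouvilleNoTypeII.ImmortalZoom
open Summit.NavierStokesRegularity.NavierStokesRegularity.Theorems.TypeIliouvilleNoTypeII.EternalSplit
open Summit.NavierStokesRegularity.NavierStokesRegularity.Theses.TypeILiouville (TypeIliouvilleL
  TypeIliouvilleNoTypeII Assembly_holds closes)

variable {ν T : ℝ} {u : ℝ → EuclideanSpace ℝ (Fin 3) → EuclideanSpace ℝ (Fin 3)}
  {p : ℝ → EuclideanSpace ℝ (Fin 3) → ℝ}

/-! ## Transfer of the `A`-slab bound alone -/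

/-- **Transfer of the scaled local energy bound to the Type-II zoom limit.**  If the
viscosity-normalised field `ũ = timeRescale ν⁻¹ ν⁻¹ u` of a classical solution on `[0, T)` has
`A(ũ; Q) ≤ I` on every parabolic ball `Q ⊆ (S₁, νT) × ℝ³`, `S₁ < νT`, then along the Type-II zoom
package (windows in the final slabs `(T - T/(j+1), T)`, zooms converging pointwise to `v`) the limit
has `A(v; Q_r(z)) ≤ I` for EVERY parabolic ball of `ℝ × ℝ³` (transport `cknAEss_windowZoom`, image
balls eventually inside the slab `image_ball_subset_slab`, Fatou `cknAEss_zoomLimit_le`). [folklore] -/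
theorem transfer_cknAEssBound (hν : 0 < ν) (hT : 0 < T)
    (hsol : IsClassicalNSSolutionOn (Ico 0 T) ν 0 u p) {S₁ : ℝ} (hS₁ : S₁ < ν * T) {I : ℝ≥0∞}
    (hA : ∀ r : ℝ, 0 < r → ∀ z : ℝ × EuclideanSpace ℝ (Fin 3),
      parabolicCylinder r z ⊆ Ioo S₁ (ν * T) ×ˢ univ → cknAEss r z (timeRescale ν⁻¹ ν⁻¹ u) ≤ I)
    {tc M : ℕ → ℝ} {xc : ℕ → EuclideanSpace ℝ (Fin 3)}
    {v : ℝ → EuclideanSpace ℝ (Fin 3) → EuclideanSpace ℝ (Fin 3)}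
    (hM : ∀ j, 0 < M j)
    (hsub : ∀ j : ℕ,
      Icc (tc j - j * ν / M j ^ 2) (tc j + j * ν / M j ^ 2) ⊆ Ioo (T - T / (j + 1)) T)
    (hval : ∀ s y, Tendsto (fun j => ((M j)⁻¹ • stPull (ν / M j ^ 2) (ν / M j) (tc j) (xc j) u) s y)
      atTop (𝓝 (v s y))) :
    ∀ r : ℝ, 0 < r → ∀ z : ℝ × EuclideanSpace ℝ (Fin 3), cknAEss r z v ≤ I := by
  intro r hr z
  -- eventually: the rescaled times of the ball lie in `(-j, j)`, and `ν (T - T/(j+1)) ≥ S₁`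
  have hev1 : ∀ᶠ j : ℕ in atTop, -(j : ℝ) < z.1 - r ^ 2 ∧ z.1 < (j : ℝ) := by
    obtain ⟨n, hn⟩ := exists_nat_ge (|z.1| + r ^ 2 + 1)
    refine eventually_atTop.2 ⟨n, fun j hj => ?_⟩
    have hj' : (n : ℝ) ≤ j := by exact_mod_cast hj
    constructor <;> cases abs_cases z.1 <;> nlinarith [sq_nonneg r]
  have hev2 : ∀ᶠ j : ℕ in atTop, S₁ ≤ ν * (T - T / ((j : ℝ) + 1)) := by
    have h0 : Tendsto (fun j : ℕ => T / ((j : ℝ) + 1)) atTop (𝓝 0) := by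
      have h := tendsto_one_div_add_atTop_nhds_zero_nat.const_mul T
      rw [mul_zero] at h
      exact h.congr fun j => by ring
    have ht : Tendsto (fun j : ℕ => ν * (T - T / ((j : ℝ) + 1))) atTop (𝓝 (ν * (T - 0))) :=
      (h0.const_sub T).const_mul ν
    rw [sub_zero] at ht
    exact ht.eventually (eventually_ge_nhds hS₁)
  -- hence the image balls lie in the slab, where the hypothesis applies
  refine cknAEss_zoomLimit_le hν hT hsol hM hsub hval ?_
  filter_upwards [hev1, hev2] with j hj1 hj2
  have himg :
      parabolicCylinder (ν / M j * r) (stAffine ((ν / M j) ^ 2) (ν / M j) (ν * tc j) (xc j) z) ⊆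
        Ioo S₁ (ν * T) ×ˢ univ :=
    (image_ball_subset_slab (x₀ := xc j) hν (hM j) (hsub j) hj1.1 hj1.2).trans
      (prod_mono (Ioo_subset_Ioo_left hj2) Subset.rfl)
  rw [cknAEss_windowZoom hν (hM j) hr]
  exact hA _ (mul_pos (div_pos hν (hM j)) hr) _ himg

/-! ## The Type-I rate, the crux and Clay (A) from the `A`-slab bound, modulo (L) -/

/-- **KILL, per solution, modulo (L): the `A`-slab bound forces the Type-I rate.**  Let `(u, p)` be
maximal with lifespan `T`, Leray–Hopf from a rapidly decaying datum, and suppose its normalised field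
has `A(ũ; Q) ≤ I < ∞` on every parabolic ball of a final slab `(S₁, νT) × ℝ³`.  Under KNSS's (L) the
solution is Type I at `T`: otherwise the Type-II zoom package gives an eternal limit with
`‖v(0,0)‖ ≥ 1/2` and `A(v; Q) ≤ I` on all balls (`transfer_cknAEssBound`), which (L) kills
(`eternal_eq_zero_of_liouvilleL_of_cknAEss_le`). [cite: KochNadirashviliSereginSverak2009, §1 conjecture (L) and §6 Prop. 6.1 (arXiv:0709.3599)] -/
theorem isTypeIBlowup_of_cknAEssSlab_of_liouvilleL (hL : TypeIliouvilleL) (hν : 0 < ν) (hT : 0 < T)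
    (hmax : IsMaximalSmoothSolution ν 0 u p T) (hLH : IsLerayHopfOn T ν 0 (u 0) u)
    (hdec : HasRapidSpatialDecay (u 0)) {S₁ : ℝ} (hS₁ : S₁ < ν * T) {I : ℝ≥0∞} (hI : I ≠ ⊤)
    (hA : ∀ r : ℝ, 0 < r → ∀ z : ℝ × EuclideanSpace ℝ (Fin 3),
      parabolicCylinder r z ⊆ Ioo S₁ (ν * T) ×ˢ univ → cknAEss r z (timeRescale ν⁻¹ ν⁻¹ u) ≤ I) :
    IsTypeIBlowup u T := by
  by_contra hII
  obtain ⟨tc, M, xc, v, hM, hsub, -, -, hv, hdiv, hmild, hvbd, h0, hval, -⟩ :=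
    exists_typeIIZoomPackage ν T hν hT u p hmax hLH hdec hII
  have hAv := transfer_cknAEssBound hν hT hmax.1 hS₁ hA hM hsub hval
  have h00 : v 0 0 = 0 :=
    eternal_eq_zero_of_liouvilleL_of_cknAEss_le hL v hv hdiv hmild ⟨2, hvbd⟩ hI hAv 0 0
  rw [h00, norm_zero] at h0
  linarith

/-- **`NoTypeII ⇐ ASlab ∧ (L)`, BY NAME.**  If every maximal Leray–Hopf solution from a rapidly
decaying datum obeys the `A`-slab bound (some `S₁ < νT`, `I ≠ ∞`, `A(ũ; Q) ≤ I` on every parabolic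
ball `Q ⊆ (S₁, νT) × ℝ³`) and KNSS's Liouville conjecture (L) holds, then `TypeIliouvilleNoTypeII`
(stmt-NavierStokesRegularity-0056). [cite: KochNadirashviliSereginSverak2009, §1 conjecture (L) and §6 (arXiv:0709.3599)] -/
theorem typeIliouvilleNoTypeII_of_cknAEssSlab_of_liouvilleL
    (hS : ∀ (ν T : ℝ), 0 < ν → 0 < T →
      ∀ (u : ℝ → EuclideanSpace ℝ (Fin 3) → EuclideanSpace ℝ (Fin 3))
        (p : ℝ → EuclideanSpace ℝ (Fin 3) → ℝ),
      IsMaximalSmoothSolution ν 0 u p T → IsLerayHopfOn T ν 0 (u 0) u → HasRapidSpatialDecay (u 0) →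
      ∃ S₁ : ℝ, S₁ < ν * T ∧ ∃ I : ℝ≥0∞, I ≠ ⊤ ∧
        ∀ r : ℝ, 0 < r → ∀ z : ℝ × EuclideanSpace ℝ (Fin 3),
          parabolicCylinder r z ⊆ Ioo S₁ (ν * T) ×ˢ univ →
          cknAEss r z (timeRescale ν⁻¹ ν⁻¹ u) ≤ I)
    (hL : TypeIliouvilleL) : TypeIliouvilleNoTypeII := by
  intro ν T hν hT u p hmax hLH hdec
  obtain ⟨S₁, hS₁, I, hI, hA⟩ := hS ν T hν hT u p hmax hLH hdec
  exact isTypeIBlowup_of_cknAEssSlab_of_liouvilleL hL hν hT hmax hLH hdec hS₁ hI hA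

/-- **`Clay (A) ⇐ ASlab ∧ (L)`.**  The `A`-slab bound for every maximal Leray–Hopf solution from
rapidly decaying data together with KNSS's Liouville conjecture (L) gives the Clay Millennium
statement (A), through the deciding theorem of route `TypeILiouville` (`closes`, with the PROVED items
`Assembly_holds` and `typeILiouville_typeIliouvilleLKillsTypeI_proof`).  Both hypotheses are OPEN:
a relocation of that route's Type-II residual to ONE scalar a-priori estimate, not a regularity
claim. [cite: KochNadirashviliSereginSverak2009, §1 and §6 Prop. 6.1 (arXiv:0709.3599)] -/
theorem navierStokesRegularity_of_cknAEssSlab_of_liouvilleL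
    (hS : ∀ (ν T : ℝ), 0 < ν → 0 < T →
      ∀ (u : ℝ → EuclideanSpace ℝ (Fin 3) → EuclideanSpace ℝ (Fin 3))
        (p : ℝ → EuclideanSpace ℝ (Fin 3) → ℝ),
      IsMaximalSmoothSolution ν 0 u p T → IsLerayHopfOn T ν 0 (u 0) u → HasRapidSpatialDecay (u 0) →
      ∃ S₁ : ℝ, S₁ < ν * T ∧ ∃ I : ℝ≥0∞, I ≠ ⊤ ∧
        ∀ r : ℝ, 0 < r → ∀ z : ℝ × EuclideanSpace ℝ (Fin 3),
          parabolicCylinder r z ⊆ Ioo S₁ (ν * T) ×ˢ univ →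
          cknAEss r z (timeRescale ν⁻¹ ν⁻¹ u) ≤ I)
    (hL : TypeIliouvilleL) : _root_.NavierStokesRegularity :=
  closes (typeIliouvilleNoTypeII_of_cknAEssSlab_of_liouvilleL hS hL) hL
    typeILiouville_typeIliouvilleLKillsTypeI_proof Assembly_holds

end Summit.NavierStokesRegularity.NavierStokesRegularity.Theorems.TypeIliouvilleNoTypeII.TypeIIZoom

end
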